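import Literature.AnabelianGeometry.SemiGraphs.PSCSeparatingCoveringsCutoffVertex
import Literature.AnabelianGeometry.SemiGraphs.PSCSeparatingCoveringsProofs2
import Literature.GroupTheory.CombinatorialGroupTheory.PuncturedSurfaceGroupTwoComponentBases
import HarnessLib

/-!
# [CombGC] Prop. 1.2, proof p. 9: verticial separating coverings and verticial commensurable terminality at two-component data with one UNMARKED component

Mochizuki, *A combinatorial version of the Grothendieck conjecture*, Tohoku Math. J. **59** (2007)
[CombGC], PROOF of Proposition 1.2, author's manuscript p. 9 (the separating coverings, verticial case;
typed LEVEL-WISE as `PSCDatum.VerticialSeparatingCoverings`, row P12-L01-V, instance form of abc-iut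
FACT-LIST row F-2826; consumers P12-L02/L03 `verticialOpenInterDeterminesVertex_of_separating`,
`commensurator_vertGp_eq_of_separating` of abc-iut-w5-d183) and Proposition 1.2 (ii) p. 8 "The `Aᵢ`
[verticial subgroups] are commensurably terminal in `Π_G`" (verticial part of the first clause of F-0438
`CommensurableTerminalityHolds`) [cite: MochizukiCombGC2007, Prop 1.2 proof p.9]
[cite: MochizukiCombGC2007, Prop 1.2(ii) p.8].

PROOF-ONLY file (abc-iut-f-164 gen 5) at the data of TWO-COMPONENT SHAPE WITH `C₁` UNMARKED (`s = 0`; the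
WAKE row «UNMARKED-CT» of the lineage): a pointed component `C₀` (genus `g₀`, ALL `r ≥ 1` marked points,
`2g₀ + r ≥ 2`) glued at one node to a closed component `C₁` (genus `g − g₀ ≥ 1`), over a pro-`Σ` completion
`ι : Γ_{g,r} → Π`.  Here `Π_{v₀} = cl ι⟨a_i, b_i (i < g₀), c_0, …, c_{r−1}⟩` is NOT the closure of a free
factor of `Γ_{g,r}` (it contains the boundary `ε = (∏_{i ≥ g₀}[a_i, b_i])⁻¹` of the complementary handles):
in the `c₀`-eliminating free basis `b₀` it is `cl ι⟨b₀(S_A) ∪ {ε}⟩` with `ε` a word in the letters of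
`S_B = S_Aᶜ`, and `Π_{v₁} = cl ι⟨b₀(S_B)⟩`.  The verticial separating coverings follow from the CUT-OFF
CHARACTER TWIST (`PSCSeparatingCoveringsCutoffVertex.lean`: same-vertex clause for both vertices with the
indicator characters of a letter of `S_A` resp. of `a_{g₀}`; cross-vertex clause by the same two
characters, `Ψ_B(ε) = 1` because `ε⁻¹` is a product of commutators).

* `verticialSeparatingCoverings_of_twoComponentUnmarked` — F-2826 / P12-L01-V (`V' := V`) at EVERY such
  datum (the FIRST instance at a vertex group that is not a free factor);
* `verticialRows_of_twoComponentUnmarked` — with Prop. 1.2 (i) verticial and Prop. 1.2 (ii) for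
  verticial subgroups there (w5-d183's reductions); `twoComponentUnmarkedOrigin_verticialRows` — the same
  at every origin of such data (hypothesis shape of `PSCTwoComponentUnmarkedOrigin.lean`, `Π` in `Type`).

Instance forms at data of the shape of genuine two-component curves; consistency evidence for the typed
rows, not the printed theorems for all pointed stable curves.  0 definitions; nothing here takes a side
on [IUTchIII] Cor. 3.12.
-/

noncomputable section

namespace Literature.AnabelianGeometry.SemiGraphs

open scoped Pointwise
open Literature.GroupTheory.CombinatorialGroupTheory
open Literature.GroupTheory.CombinatorialGroupTheory.PuncturedSurfaceGroup
open Literature.GroupTheory.CombinatorialGroupTheory.FreeFactorFibredTwist (lift_apply_basis)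
open Literature.GroupTheory.CombinatorialGroupTheory.FreeBasisCutoffCharacterTwist (map_eq_one_of_mem_closure)
open SemiGraphOfAnabelioids (IsProSigmaCompletion)
open SemiGraphOfAnabelioids.IsProSigmaCompletion (cutoff_exists_open_separating_sameVertex
  exists_open_separating_of_character)

universe u

namespace PSCDatum

/-! ### The two vertex groups in the `c₀`-eliminating free basis (`s = 0`) -/

section Discrete

variable {g r' g₀ : ℕ} {ε : PuncturedSurfaceGroup g (r' + 1)}
  {b₀ : FreeGroupBasis ((Fin g × Bool) ⊕ Fin r') (PuncturedSurfaceGroup g (r' + 1))}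
  (hε : ε = ((List.finRange (r' + 1)).map fun j : Fin (r' + 1) =>
        if 0 ≤ (j : ℕ) then c (g := g) j else 1).prod *
      ((List.finRange g).map fun i : Fin g => if (i : ℕ) < g₀ then
        a (r := r' + 1) i * b i * (a i)⁻¹ * (b i)⁻¹ else 1).prod)
  (ha : ∀ i, b₀ (Sum.inl (i, false)) = a i) (hb : ∀ i, b₀ (Sum.inl (i, true)) = b i)
  (hc : ∀ j : Fin r', b₀ (Sum.inr j) = c (Fin.succ j))

/-- A character with abelian values kills a windowed product of handle commutators.
[cite: MochizukiSemiAnbd2006, Ex. 2.10 p.31] -/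
theorem map_comm_prod_ite_eq_one {M : Type*} [CommGroup M] {g r : ℕ} (Φ : PuncturedSurfaceGroup g r →* M)
    (p : Fin g → Prop) [DecidablePred p] :
    Φ ((List.finRange g).map fun i : Fin g => if p i then
        a (r := r) i * b i * (a i)⁻¹ * (b i)⁻¹ else 1).prod = 1 := by
  rw [map_list_prod, List.map_map]
  refine List.prod_eq_one fun y hy => ?_
  obtain ⟨i, -, rfl⟩ := List.mem_map.mp hy
  simp only [Function.comp_apply]
  by_cases hi : p i
  · rw [if_pos hi, map_mul, map_mul, map_mul, map_inv, map_inv, mul_right_comm (Φ (a i)) (Φ (b i)),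
      mul_inv_cancel, one_mul, mul_inv_cancel]
  · rw [if_neg hi, map_one]

/-- The empty cusp window: `∏_{j<0} c_j = 1`. [cite: MochizukiSemiAnbd2006, Ex. 2.10 p.31] -/
theorem cusp_prod_lt_zero_eq_one {g r : ℕ} :
    ((List.finRange r).map fun j : Fin r => if (j : ℕ) < 0 then c (g := g) j else 1).prod = 1 := by
  refine List.prod_eq_one fun y hy => ?_
  obtain ⟨j, -, rfl⟩ := List.mem_map.mp hy
  exact if_neg (Nat.not_lt_zero _)

include hε ha hb in
/-- **The node loop is a word in the handles of the closed component**: for `s = 0`,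
`ε = (∏_{i ≥ g₀}[a_i, b_i])⁻¹ ∈ ⟨a_i, b_i : i ≥ g₀⟩ = ⟨b₀(S_B)⟩` (relation of the second component,
`nodeLoop_rel`). [cite: MochizukiSemiAnbd2006, Ex. 2.10 p.31] -/
theorem nodeLoop_mem_closure_secondHandles :
    ε ∈ Subgroup.closure (b₀ '' {x | Sum.elim (fun p : Fin g × Bool => g₀ ≤ (p.1 : ℕ))
      (fun _ : Fin r' => False) x}) := by
  classical
  have h := nodeLoop_rel (g := g) (r := r' + 1) g₀ 0 ε hε
  rw [cusp_prod_lt_zero_eq_one, mul_one] at h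
  rw [eq_inv_of_mul_eq_one_right h]
  refine Subgroup.inv_mem _ (comm_prod_ite_mem _ _ (fun i hi => ?_) (fun i hi => ?_))
  · exact Subgroup.subset_closure ⟨Sum.inl (i, false), hi, ha i⟩
  · exact Subgroup.subset_closure ⟨Sum.inl (i, true), hi, hb i⟩

include hε ha hb hc in
/-- **The first vertex group (`C₀`, all cusps) in the `c₀`-eliminating basis**: for `s = 0`,
`⟨a_i, b_i (i < g₀), c_j (all j)⟩ = ⟨b₀(S_A) ∪ {ε}⟩`, `S_A = {(i,·) : i < g₀} ∪ {all cusp letters}` —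
`c_0 = ε · ((c_1⋯c_{r'}) ∏_{i<g₀}[a_i,b_i])⁻¹`. [cite: MochizukiSemiAnbd2006, Ex. 2.10 p.31] -/
theorem closure_firstUnmarked_eq :
    Subgroup.closure {x : PuncturedSurfaceGroup g (r' + 1) |
        (∃ i : Fin g, (i : ℕ) < g₀ ∧ (x = a i ∨ x = b i)) ∨ ∃ j : Fin (r' + 1), 0 ≤ (j : ℕ) ∧ x = c j} =
      Subgroup.closure (b₀ '' {x | Sum.elim (fun p : Fin g × Bool => (p.1 : ℕ) < g₀)
        (fun _ : Fin r' => True) x} ∪ {ε}) := by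
  classical
  set S_A : Set ((Fin g × Bool) ⊕ Fin r') :=
    {x | Sum.elim (fun p : Fin g × Bool => (p.1 : ℕ) < g₀) (fun _ : Fin r' => True) x} with hS_A
  have haR : ∀ i : Fin g, (i : ℕ) < g₀ → a (r := r' + 1) i ∈ Subgroup.closure (b₀ '' S_A ∪ {ε}) :=
    fun i hi => Subgroup.subset_closure (Or.inl ⟨Sum.inl (i, false), hi, ha i⟩)
  have hbR : ∀ i : Fin g, (i : ℕ) < g₀ → b (r := r' + 1) i ∈ Subgroup.closure (b₀ '' S_A ∪ {ε}) :=
    fun i hi => Subgroup.subset_closure (Or.inl ⟨Sum.inl (i, true), hi, hb i⟩)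
  have hcR : ∀ j : Fin (r' + 1), 1 ≤ (j : ℕ) → c (g := g) j ∈ Subgroup.closure (b₀ '' S_A ∪ {ε}) := by
    intro j hj
    have hj0 : j ≠ 0 := by
      rintro rfl
      exact absurd hj (by simp)
    have e1 : b₀ (Sum.inr (j.pred hj0)) = c j := by rw [hc, Fin.succ_pred]
    rw [← e1]
    exact Subgroup.subset_closure (Or.inl ⟨Sum.inr (j.pred hj0), trivial, rfl⟩)
  have hεR : ε ∈ Subgroup.closure (b₀ '' S_A ∪ {ε}) := Subgroup.subset_closure (Or.inr rfl)
  -- `c_0 = ε · ((c_1⋯c_{r'}) ∏_{i<g₀}[a_i,b_i])⁻¹`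
  have hc0 : c (g := g) ⟨0, Nat.succ_pos r'⟩ ∈ Subgroup.closure (b₀ '' S_A ∪ {ε}) := by
    have h := nodeLoop_eq_c_mul (g := g) g₀ 0 (Nat.succ_pos r') ε hε
    have e : c (g := g) ⟨0, Nat.succ_pos r'⟩ = ε *
        (((List.finRange (r' + 1)).map fun j : Fin (r' + 1) =>
            if 0 + 1 ≤ (j : ℕ) then c (g := g) j else 1).prod *
          ((List.finRange g).map fun i : Fin g => if (i : ℕ) < g₀ then
            a (r := r' + 1) i * b i * (a i)⁻¹ * (b i)⁻¹ else 1).prod)⁻¹ := by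
      rw [h, mul_inv_cancel_right]
    rw [e]
    exact Subgroup.mul_mem _ hεR (Subgroup.inv_mem _ (Subgroup.mul_mem _
      (prod_map_finRange_ite_mem _ _ _ _ fun j hj => hcR j (by omega)) (comm_prod_ite_mem _ _ haR hbR)))
  apply le_antisymm
  · rw [Subgroup.closure_le]
    rintro x (⟨i, hi, rfl | rfl⟩ | ⟨j, -, rfl⟩)
    · exact haR i hi
    · exact hbR i hi
    · by_cases hj0 : (j : ℕ) = 0
      · have : j = ⟨0, Nat.succ_pos r'⟩ := Fin.ext hj0
        rw [this]; exact hc0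
      · exact hcR j (by omega)
  · rw [Subgroup.closure_le]
    rintro y (⟨x, hx, rfl⟩ | hy)
    · rcases x with ⟨i, _ | _⟩ | j
      · exact Subgroup.subset_closure (Or.inl ⟨i, hx, Or.inl (ha i)⟩)
      · exact Subgroup.subset_closure (Or.inl ⟨i, hx, Or.inr (hb i)⟩)
      · rw [hc j]
        exact Subgroup.subset_closure (Or.inr ⟨Fin.succ j, Nat.zero_le _, rfl⟩)
    · -- `ε = (c_0⋯c_{r'}) ∏_{i<g₀}[a_i,b_i]`, a word in the generators of the first component
      rw [Set.mem_singleton_iff] at hy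
      rw [hy, hε]
      refine Subgroup.mul_mem _ (prod_map_finRange_ite_mem _ _ _ _ fun j hj =>
          Subgroup.subset_closure (Or.inr ⟨j, hj, rfl⟩))
        (comm_prod_ite_mem _ _ (fun i hi => Subgroup.subset_closure (Or.inl ⟨i, hi, Or.inl rfl⟩))
          (fun i hi => Subgroup.subset_closure (Or.inl ⟨i, hi, Or.inr rfl⟩)))

include hε ha hb in
/-- **The second vertex group (`C₁`, closed) in the `c₀`-eliminating basis**: for `s = 0`,
`⟨a_i, b_i (i ≥ g₀), c_j (j < 0), ε⟩ = ⟨b₀(S_B)⟩`, `S_B = {(i,·) : g₀ ≤ i}` — a FREE FACTOR.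
[cite: MochizukiSemiAnbd2006, Ex. 2.10 p.31] -/
theorem closure_secondUnmarked_eq :
    Subgroup.closure {x : PuncturedSurfaceGroup g (r' + 1) |
        (∃ i : Fin g, g₀ ≤ (i : ℕ) ∧ (x = a i ∨ x = b i)) ∨
        (∃ j : Fin (r' + 1), (j : ℕ) < 0 ∧ x = c j) ∨ x = ε} =
      Subgroup.closure (b₀ '' {x | Sum.elim (fun p : Fin g × Bool => g₀ ≤ (p.1 : ℕ))
        (fun _ : Fin r' => False) x}) := by
  classical
  apply le_antisymm
  · rw [Subgroup.closure_le]
    rintro x (⟨i, hi, rfl | rfl⟩ | ⟨j, hj, rfl⟩ | rfl)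
    · exact Subgroup.subset_closure ⟨Sum.inl (i, false), hi, ha i⟩
    · exact Subgroup.subset_closure ⟨Sum.inl (i, true), hi, hb i⟩
    · exact absurd hj (Nat.not_lt_zero _)
    · exact nodeLoop_mem_closure_secondHandles hε ha hb
  · rw [Subgroup.closure_le]
    rintro _ ⟨x, hx, rfl⟩
    rcases x with ⟨i, _ | _⟩ | j
    · exact Subgroup.subset_closure (Or.inl ⟨i, hx, Or.inl (ha i)⟩)
    · exact Subgroup.subset_closure (Or.inl ⟨i, hx, Or.inr (hb i)⟩)
    · exact absurd hx id

end Discrete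

/-! ### F-2826 at the two-component unmarked datum -/

section Datum

variable {P : Type*} [Group P] [TopologicalSpace P] [IsTopologicalGroup P]
variable [CompactSpace P] [TotallyDisconnectedSpace P] {Sigma : Set ℕ} {g r : ℕ}

/-- **F-2826 / row P12-L01-V (`VerticialSeparatingCoverings`, `V' := V`) at EVERY datum of
two-component shape with `C₁` UNMARKED** (`s = 0`, `r ≥ 1`, `2g₀ + r ≥ 2`, `g − g₀ ≥ 1`): the first
instance of the verticial separating coverings of [CombGC] Prop. 1.2, proof p. 9, at a vertex group that is
NOT the closure of a free factor of `π₁` (`Π_{v₀} ∋ ι(ε)`, `ε⁻¹ = ∏_{i≥g₀}[a_i,b_i]`).  Same-vertex pairs: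
cut-off character twist at both vertices; cross-vertex pairs: the indicator characters of a letter of
`C₀` and of `a_{g₀}`. [cite: MochizukiCombGC2007, Prop 1.2 proof p.9] -/
theorem verticialSeparatingCoverings_of_twoComponentUnmarked (hne : Sigma.Nonempty)
    (hprime : ∀ p ∈ Sigma, p.Prime) (ι : PuncturedSurfaceGroup g r →* P)
    (hι : IsProSigmaCompletion Sigma ι) (G : PSCDatum P) {g₀ s : ℕ} (hs : s = 0)
    (hr : 1 ≤ r) (hst₀ : 1 ≤ g₀ ∨ 2 ≤ r) (hg₁ : 1 ≤ g - g₀)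
    (v₀ v₁ : G.graph.V) (hV : ∀ w, w = v₀ ∨ w = v₁) (ε : PuncturedSurfaceGroup g r)
    (hε : ε = ((List.finRange r).map fun j : Fin r =>
            if s ≤ (j : ℕ) then PuncturedSurfaceGroup.c (g := g) j else 1).prod *
          ((List.finRange g).map fun i : Fin g => if (i : ℕ) < g₀ then
            PuncturedSurfaceGroup.a (r := r) i * PuncturedSurfaceGroup.b i *
              (PuncturedSurfaceGroup.a i)⁻¹ * (PuncturedSurfaceGroup.b i)⁻¹ else 1).prod)
    (hV₀ : G.vertGp v₀ = ((Subgroup.closure {x : PuncturedSurfaceGroup g r |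
            (∃ i : Fin g, (i : ℕ) < g₀ ∧ (x = PuncturedSurfaceGroup.a i ∨ x = PuncturedSurfaceGroup.b i)) ∨
            ∃ j : Fin r, s ≤ (j : ℕ) ∧ x = PuncturedSurfaceGroup.c j}).map ι).topologicalClosure)
    (hV₁ : G.vertGp v₁ = ((Subgroup.closure {x : PuncturedSurfaceGroup g r |
            (∃ i : Fin g, g₀ ≤ (i : ℕ) ∧ (x = PuncturedSurfaceGroup.a i ∨ x = PuncturedSurfaceGroup.b i)) ∨
            (∃ j : Fin r, (j : ℕ) < s ∧ x = PuncturedSurfaceGroup.c j) ∨ x = ε}).map ι).topologicalClosure) :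
    G.VerticialSeparatingCoverings := by
  classical
  subst hs
  obtain ⟨r', rfl⟩ : ∃ r', r = r' + 1 := ⟨r - 1, by omega⟩
  obtain ⟨ℓ, hℓS⟩ := hne
  have hℓ : ℓ.Prime := hprime ℓ hℓS
  have hg₀g : g₀ < g := by omega
  -- the `c₀`-eliminating free basis and the two letter sets
  obtain ⟨b₀, ha, hb, hc⟩ := exists_freeGroupBasis_elim_zero g r'
  set S_A : Set ((Fin g × Bool) ⊕ Fin r') :=
    {x | Sum.elim (fun p : Fin g × Bool => (p.1 : ℕ) < g₀) (fun _ : Fin r' => True) x} with hS_A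
  set S_B : Set ((Fin g × Bool) ⊕ Fin r') :=
    {x | Sum.elim (fun p : Fin g × Bool => g₀ ≤ (p.1 : ℕ)) (fun _ : Fin r' => False) x} with hS_B
  have hAB : ∀ x, x ∉ S_A → x ∈ S_B := by
    rintro (⟨i, t⟩ | j) hx
    · exact Nat.le_of_not_lt hx
    · exact absurd trivial hx
  have hBA : ∀ x, x ∈ S_B → x ∉ S_A := by
    rintro (⟨i, t⟩ | j) hx hx'
    · exact Nat.not_lt.mpr hx hx'
    · exact hx
  have hA_eq := closure_firstUnmarked_eq (g₀ := g₀) hε ha hb hc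
  have hB_eq := closure_secondUnmarked_eq (g₀ := g₀) hε ha hb
  have hεB : ε ∈ Subgroup.closure (b₀ '' S_B) := nodeLoop_mem_closure_secondHandles hε ha hb
  -- the indicator characters: `Ψ_A` of a letter `i₀ ∈ S_A`, `Ψ_B` of `a_{g₀}`
  have hSA_ne : ∃ i₀, i₀ ∈ S_A := by
    rcases hst₀ with h | h
    · exact ⟨Sum.inl (⟨0, by omega⟩, false), show ((0 : ℕ)) < g₀ from h⟩
    · exact ⟨Sum.inr ⟨0, by omega⟩, trivial⟩
  obtain ⟨i₀, hi₀⟩ := hSA_ne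
  set j₀ : (Fin g × Bool) ⊕ Fin r' := Sum.inl (⟨g₀, hg₀g⟩, false) with hj₀
  have hj₀B : j₀ ∈ S_B := le_refl g₀
  let Ψ_A : PuncturedSurfaceGroup g (r' + 1) →* Multiplicative ℤ :=
    b₀.lift fun x => if x = i₀ then Multiplicative.ofAdd 1 else 1
  let Ψ_B : PuncturedSurfaceGroup g (r' + 1) →* Multiplicative ℤ :=
    b₀.lift fun x => if x = j₀ then Multiplicative.ofAdd 1 else 1
  have hΨ_A : ∀ x, Ψ_A (b₀ x) = if x = i₀ then Multiplicative.ofAdd 1 else 1 :=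
    fun x => lift_apply_basis b₀ _ x
  have hΨ_B : ∀ x, Ψ_B (b₀ x) = if x = j₀ then Multiplicative.ofAdd 1 else 1 :=
    fun x => lift_apply_basis b₀ _ x
  have hone : (Multiplicative.ofAdd (1 : ℤ)) ≠ 1 := fun h =>
    one_ne_zero (Multiplicative.ofAdd.injective (h.trans ofAdd_zero.symm))
  have hΨ_A_out : ∀ x, x ∉ S_A → Ψ_A (b₀ x) = 1 := fun x hx => by
    have hxi : x ≠ i₀ := by
      rintro rfl
      exact hx hi₀
    rw [hΨ_A, if_neg hxi]
  have hΨ_B_out : ∀ x, x ∉ S_B → Ψ_B (b₀ x) = 1 := fun x hx => by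
    have hxj : x ≠ j₀ := by
      rintro rfl
      exact hx hj₀B
    rw [hΨ_B, if_neg hxj]
  have hΨ_A_i₀ : Ψ_A (b₀ i₀) ≠ 1 := by rw [hΨ_A, if_pos rfl]; exact hone
  have hΨ_B_j₀ : Ψ_B (b₀ j₀) ≠ 1 := by rw [hΨ_B, if_pos rfl]; exact hone
  -- `Ψ_A` kills `⟨b₀(S_B)⟩ ⊇ Π_{v₁}`'s generators; `Ψ_B` kills `⟨b₀(S_A) ∪ {ε}⟩`
  have hΨ_A_B : ∀ x ∈ Subgroup.closure (b₀ '' S_B), Ψ_A x = 1 := fun x hx =>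
    map_eq_one_of_mem_closure b₀ Ψ_A S_B (fun i hi => hΨ_A_out i (hBA i hi)) hx
  have hΨ_B_ε : Ψ_B ε = 1 := by
    have h := nodeLoop_rel (g := g) (r := r' + 1) g₀ 0 ε hε
    rw [cusp_prod_lt_zero_eq_one, mul_one] at h
    rw [eq_inv_of_mul_eq_one_right h, map_inv, map_comm_prod_ite_eq_one, inv_one]
  have hΨ_B_A : ∀ x ∈ Subgroup.closure (b₀ '' S_A ∪ {ε}), Ψ_B x = 1 := by
    intro x hx
    rw [← MonoidHom.mem_ker]
    refine (Subgroup.closure_le Ψ_B.ker).mpr ?_ hx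
    rintro y (⟨i, hi, rfl⟩ | rfl)
    · exact hΨ_B_out i fun hiB => hBA i hiB hi
    · exact hΨ_B_ε
  -- the two vertex groups in the basis `b₀`
  have hV₀' : G.vertGp v₀ = ((Subgroup.closure (b₀ '' S_A ∪ {ε})).map ι).topologicalClosure := by
    rw [hV₀, hA_eq]
  have hV₁' : G.vertGp v₁ = ((Subgroup.closure (b₀ '' S_B)).map ι).topologicalClosure := by
    rw [hV₁, hB_eq]
  have hE_A : ({ε} : Set (PuncturedSurfaceGroup g (r' + 1))) ⊆
      Subgroup.closure (b₀ '' {x | x ∈ S_A → Ψ_A (b₀ x) = 1}) :=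
    Set.singleton_subset_iff.mpr
      (Subgroup.closure_mono (Set.image_mono
        (fun x hx hxA => absurd hxA (hBA x hx) : S_B ⊆ {x | x ∈ S_A → Ψ_A (b₀ x) = 1})) hεB)
  have hE_B : (∅ : Set (PuncturedSurfaceGroup g (r' + 1))) ⊆
      Subgroup.closure (b₀ '' {x | x ∈ S_B → Ψ_B (b₀ x) = 1}) := Set.empty_subset _
  have hi₀V₀ : ι (b₀ i₀) ∈ G.vertGp v₀ := by
    rw [hV₀']
    exact Subgroup.le_topologicalClosure _ (Subgroup.mem_map_of_mem ι
      (Subgroup.subset_closure (Or.inl ⟨i₀, hi₀, rfl⟩)))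
  have hj₀V₁ : ι (b₀ j₀) ∈ G.vertGp v₁ := by
    rw [hV₁']
    exact Subgroup.le_topologicalClosure _ (Subgroup.mem_map_of_mem ι
      (Subgroup.subset_closure ⟨j₀, hj₀B, rfl⟩))
  refine G.verticialSeparatingCoverings_of_sameVertex_of_crossVertex ?_ ?_
  · -- two level vertices over the SAME vertex: cut-off character twist
    intro V hVn hVo v γ₁ γ₂ hne
    haveI := hVn
    rcases hV v with rfl | rfl
    · exact cutoff_exists_open_separating_sameVertex hι b₀ S_A Ψ_A hΨ_A_out {ε} hE_A
        (Subgroup.closure (b₀ '' S_A ∪ {ε})) rfl hi₀ hΨ_A_i₀ hℓ hℓS _ hV₀' V hVo γ₁ γ₂ hne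
    · exact cutoff_exists_open_separating_sameVertex hι b₀ S_B Ψ_B hΨ_B_out ∅ hE_B
        (Subgroup.closure (b₀ '' S_B)) (by rw [Set.union_empty]) hj₀B hΨ_B_j₀ hℓ hℓS _ hV₁' V hVo
        γ₁ γ₂ hne
  · -- level vertices over DIFFERENT vertices: the two indicator characters
    intro V hVn hVo w₁ w₂ γ₁ γ₂ hw
    haveI := hVn
    rcases hV w₁ with rfl | rfl <;> rcases hV w₂ with rfl | rfl
    · exact absurd rfl hw
    · exact exists_open_separating_of_character hι hℓ hℓS Ψ_A _ _ hV₁' hΨ_A_B _ (b₀ i₀) hi₀V₀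
        hΨ_A_i₀ V hVo γ₁ γ₂
    · exact exists_open_separating_of_character hι hℓ hℓS Ψ_B _ _ hV₀' hΨ_B_A _ (b₀ j₀) hj₀V₁
        hΨ_B_j₀ V hVo γ₁ γ₂
    · exact absurd rfl hw

/-- **F-2826 with its P12-L02/L03 consequences at every two-component unmarked datum**: the verticial
separating coverings, Prop. 1.2 (i) verticial case ("if `Π_{v₁}^{γ₁} ∩ Π_{v₂}^{γ₂}` is open in the first
then `v₁ = v₂`"), and Prop. 1.2 (ii) for VERTICIAL subgroups ("the `A_i` are commensurably terminal") —
by abc-iut-w5-d183's reductions `verticialOpenInterDeterminesVertex_of_separating`,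
`commensurator_vertGp_eq_of_separating`. [cite: MochizukiCombGC2007, Prop 1.2(ii) p.8] -/
theorem verticialRows_of_twoComponentUnmarked (hne : Sigma.Nonempty)
    (hprime : ∀ p ∈ Sigma, p.Prime) (ι : PuncturedSurfaceGroup g r →* P)
    (hι : IsProSigmaCompletion Sigma ι) (G : PSCDatum P) {g₀ s : ℕ} (hs : s = 0)
    (hr : 1 ≤ r) (hst₀ : 1 ≤ g₀ ∨ 2 ≤ r) (hg₁ : 1 ≤ g - g₀)
    (v₀ v₁ : G.graph.V) (hV : ∀ w, w = v₀ ∨ w = v₁) (ε : PuncturedSurfaceGroup g r)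
    (hε : ε = ((List.finRange r).map fun j : Fin r =>
            if s ≤ (j : ℕ) then PuncturedSurfaceGroup.c (g := g) j else 1).prod *
          ((List.finRange g).map fun i : Fin g => if (i : ℕ) < g₀ then
            PuncturedSurfaceGroup.a (r := r) i * PuncturedSurfaceGroup.b i *
              (PuncturedSurfaceGroup.a i)⁻¹ * (PuncturedSurfaceGroup.b i)⁻¹ else 1).prod)
    (hV₀ : G.vertGp v₀ = ((Subgroup.closure {x : PuncturedSurfaceGroup g r |
            (∃ i : Fin g, (i : ℕ) < g₀ ∧ (x = PuncturedSurfaceGroup.a i ∨ x = PuncturedSurfaceGroup.b i)) ∨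
            ∃ j : Fin r, s ≤ (j : ℕ) ∧ x = PuncturedSurfaceGroup.c j}).map ι).topologicalClosure)
    (hV₁ : G.vertGp v₁ = ((Subgroup.closure {x : PuncturedSurfaceGroup g r |
            (∃ i : Fin g, g₀ ≤ (i : ℕ) ∧ (x = PuncturedSurfaceGroup.a i ∨ x = PuncturedSurfaceGroup.b i)) ∨
            (∃ j : Fin r, (j : ℕ) < s ∧ x = PuncturedSurfaceGroup.c j) ∨ x = ε}).map ι).topologicalClosure) :
    G.VerticialSeparatingCoverings ∧ G.VerticialOpenInterDeterminesVertex ∧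
      ∀ A : Subgroup P, G.IsVerticial A → Subgroup.Commensurable.commensurator A = A := by
  have hsep := G.verticialSeparatingCoverings_of_twoComponentUnmarked hne hprime ι hι hs hr hst₀ hg₁ v₀ v₁
    hV ε hε hV₀ hV₁
  refine ⟨hsep, G.verticialOpenInterDeterminesVertex_of_separating hsep, ?_⟩
  rintro A ⟨v, γ, rfl⟩
  exact G.commensurator_vertGp_eq_of_separating hsep v γ

end Datum

/-! ### Origin level: every origin of two-component data with `C₁` unmarked -/

/-- **F-2826, Prop. 1.2 (i) verticial and Prop. 1.2 (ii) verticial at every origin whose data are of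
two-component shape with `C₁` unmarked** (hypothesis shape of `PSCTwoComponentUnmarkedOrigin.lean`;
profinite `Π` in `Type`). [cite: MochizukiCombGC2007, Prop 1.2(ii) p.8] -/
theorem twoComponentUnmarkedOrigin_verticialRows (Ω : PSCOrigin.{0})
    (hΩ : ∀ ⦃Q : Type⦄ [Group Q] [TopologicalSpace Q] [IsTopologicalGroup Q] (G : PSCDatum Q),
      Ω.IsOfPSCType G → CompactSpace Q ∧ T2Space Q ∧ TotallyDisconnectedSpace Q ∧
        ∃ (S : Set ℕ) (g r g₀ s : ℕ) (ι : PuncturedSurfaceGroup g r →* Q) (e : G.graph.C ≃ Fin r)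
          (v₀ v₁ : G.graph.V) (n₀ : G.graph.N) (ε : PuncturedSurfaceGroup g r),
          S.Nonempty ∧ (∀ p ∈ S, p.Prime) ∧ IsProSigmaCompletion S ι ∧ g₀ ≤ g ∧ s = 0 ∧ 1 ≤ r ∧
          (1 ≤ g₀ ∨ 2 ≤ r) ∧ 1 ≤ g - g₀ ∧
          (∀ c, G.cuspGp c =
            ((PuncturedSurfaceGroup.cuspInertia (g := g) (e c)).map ι).topologicalClosure) ∧
          (∀ w, w = v₀ ∨ w = v₁) ∧ (∀ n, n = n₀) ∧
          ε = ((List.finRange r).map fun j : Fin r =>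
            if s ≤ (j : ℕ) then PuncturedSurfaceGroup.c (g := g) j else 1).prod *
          ((List.finRange g).map fun i : Fin g => if (i : ℕ) < g₀ then
            PuncturedSurfaceGroup.a (r := r) i * PuncturedSurfaceGroup.b i *
              (PuncturedSurfaceGroup.a i)⁻¹ * (PuncturedSurfaceGroup.b i)⁻¹ else 1).prod ∧
          G.vertGp v₀ = ((Subgroup.closure {x : PuncturedSurfaceGroup g r |
            (∃ i : Fin g, (i : ℕ) < g₀ ∧ (x = PuncturedSurfaceGroup.a i ∨ x = PuncturedSurfaceGroup.b i)) ∨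
            ∃ j : Fin r, s ≤ (j : ℕ) ∧ x = PuncturedSurfaceGroup.c j}).map ι).topologicalClosure ∧
          G.vertGp v₁ = ((Subgroup.closure {x : PuncturedSurfaceGroup g r |
            (∃ i : Fin g, g₀ ≤ (i : ℕ) ∧ (x = PuncturedSurfaceGroup.a i ∨ x = PuncturedSurfaceGroup.b i)) ∨
            (∃ j : Fin r, (j : ℕ) < s ∧ x = PuncturedSurfaceGroup.c j) ∨ x = ε}).map ι).topologicalClosure ∧
          G.nodeGp n₀ = ((Subgroup.zpowers ε).map ι).topologicalClosure ∧
          G.genus v₀ = g₀ ∧ G.genus v₁ = g - g₀) :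
    ∀ ⦃Q : Type⦄ [Group Q] [TopologicalSpace Q] [IsTopologicalGroup Q] (G : PSCDatum Q),
      Ω.IsOfPSCType G → G.VerticialSeparatingCoverings ∧ G.VerticialOpenInterDeterminesVertex ∧
        ∀ A : Subgroup Q, G.IsVerticial A → Subgroup.Commensurable.commensurator A = A := by
  intro Q _ _ _ G hG
  obtain ⟨hc, -, hd, S, g, r, g₀, s, ι, e, v₀, v₁, n₀, ε, hne, hprime, hι, -, hs, hr, hst₀, hg₁, -, hV, -, hε,
    hV₀, hV₁, -, -, -⟩ := hΩ G hG
  exact G.verticialRows_of_twoComponentUnmarked hne hprime ι hι hs hr hst₀ hg₁ v₀ v₁ hV ε hε hV₀ hV₁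

end PSCDatum

end Literature.AnabelianGeometry.SemiGraphs

end
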